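import Summits.ResolutionOfSingularities.ResolutionOfSingularities.Theorems.PAlterationPialtNormalizationInConverse
import Summits.ResolutionOfSingularities.ResolutionOfSingularities.Theorems.PAlterationAssemblyPerfect
import Summits.ResolutionOfSingularities.ResolutionOfSingularities.Theorems.PAlterationPicoverToRadicialBottomFrobenius
import Summits.ResolutionOfSingularities.ResolutionOfSingularities.Theorems.PAlterationAssemblyLevels
import HarnessLib

/-!
# `Pialt` (crux stmt-ResolutionOfSingularities-0555): the Frobenius trick over perfect fields

Companion to `PAlterationPialtNormalizationInConverse.lean` (landed `--supports stmt-ResolutionOfSingularities-0555`;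
does not close the item). A new KNOWN CASE of the crux and a new TRANSFER, both over PERFECT
ground fields (Temkin 2013, Rem. 1.3.5(i): "if `[k : k^p] < ∞` then `h` is finite"; Kollár 1997,
Prop. 6.6; Stacks 0CNF):

* `exists_frobeniusCover_of_finite_universallyInjective` — **Frobenius domination.** Over a perfect
  field `K` of characteristic `p`, let `h : X → Y` be finite, universally injective and dominant
  between integral schemes, `Y` NORMAL and locally of finite type over `K`. Then there is a
  finite, universally injective, surjective `ψ : N → X` from an integral scheme `N ≅ Y`: with
  `p^e` the exponent of the purely inseparable extension `K(X)/K(Y)` and `F = F_Y^e` the `p^e`-th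
  power endomorphism of `Y` (finite since `K` is perfect), `N := Y^{L}` is the normalisation of
  `Y` in `L = K(Y)` viewed as an extension of `K(Y)` through `F^♯ = (·)^{p^e}`; `N ≅ Y` by
  `exists_isIso_comparison_of_normal` (normality of `Y`), and `ψ` comes from the universal
  property of the relative normalisation applied to `Spec K(Y) → X`, `K(X) → K(Y)`,
  `x ↦ (h^♯)⁻¹(x^{p^e})` (Mathlib `IsPurelyInseparable.iterateFrobenius`);
* `pialtConclusion_of_finite_universallyInjective_surjective_perfectField` — hence, over a
  perfect field, **the conclusion of `Pialt` ASCENDS along finite radicial surjective morphisms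
  onto normal varieties** (it always descends, `pialtConclusion_of_finite_universallyInjective_surjective`):
  `Pialt` at `Y` gives `Pialt` at `X`;
* `pialtConclusion_of_radicialCover_of_hasResolution_perfectField` — in particular **every
  finite radicial cover `X` of a normal variety `Y` admitting a resolution (e.g. `Y` regular) over
  a perfect field satisfies the conclusion of `Pialt`**: the class of the route's other crux
  `Picover` (whose RESOLUTION is open from dimension 4) is not an obstruction to `Pialt` over
  perfect fields.

Sources: M. Temkin, J. Algebra 373 (2013), Rem. 1.3.5(i); J. Kollár, *Quotient spaces modulo
algebraic groups*, Ann. of Math. 145 (1997), Prop. 6.6; Stacks Project, Tags 0CNF, 0CC6, 035Q.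
-/

noncomputable section

set_option linter.dupNamespace false -- mandated namespace of this single-conjunct summit

namespace Summit.ResolutionOfSingularities.ResolutionOfSingularities.Theorems

open CategoryTheory AlgebraicGeometry TopologicalSpace Opposite
open Literature.AlgebraicGeometry.Resolution Literature.AlgebraicGeometry.Motives
open Literature.AlgebraicGeometry.Motives.RatFn
open Summit.ResolutionOfSingularities.ResolutionOfSingularities.Theorems.Picover.FunctionFieldRadicial
open Summit.ResolutionOfSingularities.ResolutionOfSingularities.Theses.PAlteration (Pialt)

universe u

/-! ## A cancellation lemma (`universallyInjective_of_comp` is in `PAlterationAssemblyLevels`) -/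

/-- If `f ≫ g` is surjective and `g` is injective on points then `f` is surjective. [folklore] -/
theorem surjective_of_comp_of_injective {X Y Z : Scheme.{u}} (f : X ⟶ Y) (g : Y ⟶ Z)
    (hfg : Function.Surjective (f ≫ g).base) (hg : Function.Injective g.base) :
    Function.Surjective f.base := by
  intro y
  obtain ⟨x, hx⟩ := hfg (g.base y)
  exact ⟨x, hg (by simpa [Scheme.Hom.comp_base] using hx)⟩

/-! ## The function-field map of a power endomorphism -/

/-- On the function field of an integral scheme the `n`-th power endomorphism induces `y ↦ yⁿ`.
[folklore] -/
theorem functionFieldMap_powEndo (Y : Scheme.{u}) [IsIntegral Y] (n : ℕ) (hn : n ≠ 0)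
    (hadd : ∀ (U : Y.Opens) (a b : Γ(Y, U)), (a + b) ^ n = a ^ n + b ^ n)
    [IsDominant (powEndo Y n hn hadd)] (y : Y.functionField) :
    RatFn.functionFieldMap (powEndo Y n hn hadd) y = y ^ n := by
  have h1 : Y.presheaf.stalkSpecializes (RatFn.specializes_genericPoint (powEndo Y n hn hadd)) =
      𝟙 _ := TopCat.Presheaf.stalkSpecializes_refl _ _
  simp only [RatFn.functionFieldMap, h1]
  exact powEndo_stalkMap_apply Y n hn hadd (genericPoint Y) y

/-! ## Frobenius domination over a perfect field -/

/-- **Frobenius domination of a finite radicial cover** (Temkin 2013, Rem. 1.3.5(i); Kollár 1997,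
Prop. 6.6; Stacks 0CNF). Over a perfect field `K` of characteristic `p`, let `h : X → Y` be
finite, universally injective and dominant between integral schemes with `Y` normal and locally
of finite type over `K`. Then some integral scheme `N` ISOMORPHIC to `Y` maps finitely, universally
injectively and surjectively onto `X`. Construction: `e :=` the exponent of the finite purely
inseparable extension `K(X)/K(Y)`; `F := F_Y^e` the `p^e`-th power endomorphism of `Y`, FINITE as
`K` is perfect (`isFinite_powEndo`); `L := K(Y)` as an extension of `K(Y)` via `F^♯ = (·)^{p^e}`;
`N := Y^L`, with `Y^L ≅ Y` (`exists_isIso_comparison_of_normal`, `Y` normal); `ψ : Y^L → X` by the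
universal property of the relative normalisation for `Spec L → X → Y`, where `Spec L → X` is
`Spec` of `K(X) → K(Y)`, `x ↦ (h^♯)⁻¹(x^{p^e})` (`IsPurelyInseparable.iterateFrobenius`); then
`ψ ≫ h = (Y^L → Y)` is finite, radicial and surjective, whence so is `ψ` (`h` being finite and
injective). [cite: Temkin2013, Rem. 1.3.5(i); Kollar1997, Prop. 6.6] -/
theorem exists_frobeniusCover_of_finite_universallyInjective {p : ℕ} (hp : p.Prime) (K : Type)
    [Field K] [CharP K p] [PerfectField K] (X Y : Scheme.{0}) [IsIntegral X] [IsIntegral Y]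
    (f : Y ⟶ Spec (.of K)) [LocallyOfFiniteType f] (h : X ⟶ Y) [IsFinite h]
    [UniversallyInjective h] [IsDominant h] (hYn : ∀ y : Y, IsIntegrallyClosed (Y.presheaf.stalk y)) :
    ∃ (N : Scheme.{0}) (ψ : N ⟶ X) (φ : N ⟶ Y), IsIntegral N ∧ IsIso φ ∧ IsFinite ψ ∧
      UniversallyInjective ψ ∧ Function.Surjective ψ.base := by
  haveI : Fact p.Prime := ⟨hp⟩
  -- characteristic `p` on `Y` and on `K(Y)`
  have hpY : (p : Γ(Y, ⊤)) = 0 := natCast_appTop_eq_zero p f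
  haveI : CharP Y.functionField p := by
    haveI : Nonempty (⊤ : Y.Opens) := ⟨⟨genericPoint Y, trivial⟩⟩
    exact (((Y.germToFunctionField ⊤).hom.comp
      ((f.appTop).hom.comp (Scheme.ΓSpecIso (.of K)).inv.hom)).charP_iff_charP p).mp inferInstance
  haveI : ExpChar Y.functionField p := ExpChar.prime hp
  -- `K(X)/K(Y)` is finite purely inseparable, of exponent `p^e`
  obtain ⟨_, ⟨V, hVaff, rfl⟩, hξV, -⟩ :=
    Y.isBasis_affineOpens.exists_subset_of_mem_open (Set.mem_univ (genericPoint Y)) isOpen_univ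
  haveI : FiniteDimensional Y.functionField (FunctionFieldOver h) :=
    FunctionFieldOver.finiteDimensional h hVaff hξV
  haveI : IsPurelyInseparable Y.functionField (FunctionFieldOver h) :=
    stub_functionFieldRadicial X Y h
  set e := IsPurelyInseparable.exponent Y.functionField (FunctionFieldOver h) with he
  let τ : FunctionFieldOver h →+* Y.functionField :=
    IsPurelyInseparable.iterateFrobenius Y.functionField (FunctionFieldOver h) p le_rfl
  have hτ : ∀ y : Y.functionField,
      τ (algebraMap Y.functionField (FunctionFieldOver h) y) = y ^ p ^ e := fun y =>
    IsPurelyInseparable.iterateFrobenius_algebraMap (FunctionFieldOver h) p le_rfl y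
  -- the finite Frobenius power `F = F_Y^e`
  have hadd := add_pow_sections p hpY e
  set F := powEndo Y (p ^ e) (pow_ne_zero e hp.ne_zero) hadd with hFdef
  haveI : IsFinite F := isFinite_powEndo p f e hadd
  haveI : UniversallyInjective F := universallyInjective_powEndo Y p e hadd hpY
  haveI : Surjective F := ⟨fun x => ⟨x, rfl⟩⟩
  have hF : ∀ y : Y.functionField, RatFn.functionFieldMap F y = y ^ p ^ e :=
    functionFieldMap_powEndo Y (p ^ e) _ hadd
  -- `L := K(Y)` over `K(Y)` via `F^♯`; `N := Y^L ≅ Y`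
  obtain ⟨φ, hφ, -, -⟩ := exists_isIso_comparison_of_normal K Y Y f F hYn
  -- `Spec L → X`, `Spec` of `τ : K(X) → K(Y) = L`
  let τ' : CommRingCat.of X.functionField ⟶ CommRingCat.of (FunctionFieldOver F) :=
    CommRingCat.ofHom τ
  let f₁ : Spec (.of (FunctionFieldOver F)) ⟶ X := Spec.map τ' ≫ fromSpecFunctionField X
  have H : fromSpecExtension Y (FunctionFieldOver F) = f₁ ≫ h := by
    have h1 : f₁ ≫ h = Spec.map τ' ≫ fromSpecExtension Y (FunctionFieldOver h) := by
      simp only [f₁, Category.assoc,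
        Picover.OfNormalizationIn.fromSpecExtension_functionFieldOver h]
    rw [h1]
    change Spec.map (CommRingCat.ofHom (algebraMap Y.functionField (FunctionFieldOver F))) ≫
        fromSpecFunctionField Y =
      Spec.map τ' ≫ Spec.map (CommRingCat.ofHom
        (algebraMap Y.functionField (FunctionFieldOver h))) ≫ fromSpecFunctionField Y
    rw [← Category.assoc, ← Spec.map_comp]
    congr 2
    ext y
    change RatFn.functionFieldMap F y = τ (algebraMap Y.functionField (FunctionFieldOver h) y)
    rw [hF, hτ]
  let ψ : normalizationIn Y (FunctionFieldOver F) ⟶ X :=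
    (fromSpecExtension Y (FunctionFieldOver F)).normalizationDesc f₁ h H
  have hψh : ψ ≫ h = normalizationInι Y (FunctionFieldOver F) :=
    (fromSpecExtension Y (FunctionFieldOver F)).normalizationDesc_comp f₁ h H
  -- `ψ ≫ h = ι` is finite, radicial and surjective, hence so is `ψ`
  haveI : FiniteDimensional Y.functionField (FunctionFieldOver F) :=
    FunctionFieldOver.finiteDimensional F hVaff hξV
  haveI : IsPurelyInseparable Y.functionField (FunctionFieldOver F) :=
    stub_functionFieldRadicial Y Y F
  haveI : IsFinite (normalizationInι Y (FunctionFieldOver F)) :=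
    isFinite_normalizationInι Y (FunctionFieldOver F) f
  haveI : UniversallyInjective (normalizationInι Y (FunctionFieldOver F)) :=
    universallyInjective_normalizationInι_of_isPurelyInseparable Y (FunctionFieldOver F) p hYn
  have hψfin : IsFinite ψ := by
    have h1 : IsFinite (ψ ≫ h) := by rw [hψh]; infer_instance
    exact IsFinite.comp_iff.mp h1
  have hψui : UniversallyInjective ψ := by
    haveI : UniversallyInjective (ψ ≫ h) := by rw [hψh]; infer_instance
    exact universallyInjective_of_comp ψ h
  have hψsurj : Function.Surjective ψ.base := by
    refine surjective_of_comp_of_injective ψ h ?_ h.injective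
    rw [hψh]
    exact (surjective_normalizationInι Y (FunctionFieldOver F)).surj
  exact ⟨normalizationIn Y (FunctionFieldOver F), ψ, φ, inferInstance, hφ, hψfin, hψui, hψsurj⟩

/-! ## Ascent of the conclusion of `Pialt` along finite radicial covers (perfect base field) -/

/-- **Over a perfect field, the conclusion of `Pialt` ascends along finite radicial surjective
morphisms onto normal varieties**: for `h : X → Y` finite, universally injective and surjective
between integral schemes, `Y` normal and locally of finite type over a perfect field of
characteristic `p`, a purely inseparable regular alteration of `Y` yields one of `X` — transport
it along `Y ≅ N` and compose with the Frobenius cover `N → X`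
(`exists_frobeniusCover_of_finite_universallyInjective`). Together with the unconditional
descent (`pialtConclusion_of_finite_universallyInjective_surjective`) the conclusion of `Pialt`
is INVARIANT under such covers over perfect fields. [cite: Temkin2013, Rem. 1.3.5(i)] -/
theorem pialtConclusion_of_finite_universallyInjective_surjective_perfectField {p : ℕ}
    (hp : p.Prime) (K : Type) [Field K] [CharP K p] [PerfectField K] (X Y : Scheme.{0})
    [IsIntegral X] [IsIntegral Y] (f : Y ⟶ Spec (.of K)) [LocallyOfFiniteType f] (h : X ⟶ Y)
    [IsFinite h] [UniversallyInjective h] (hsurj : Function.Surjective h.base)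
    (hYn : ∀ y : Y, IsIntegrallyClosed (Y.presheaf.stalk y))
    (hY : ∃ (Y' : Scheme.{0}) (g : Y' ⟶ Y), IsProper g ∧ IsIntegral Y' ∧ Scheme.IsRegular Y' ∧
      Function.Surjective g.base ∧ ∃ U : Y.Opens, Dense (U : Set Y) ∧ IsFinite (g ∣_ U) ∧
        UniversallyInjective (g ∣_ U)) :
    ∃ (X' : Scheme.{0}) (g : X' ⟶ X), IsProper g ∧ IsIntegral X' ∧ Scheme.IsRegular X' ∧
      Function.Surjective g.base ∧ ∃ U : X.Opens, Dense (U : Set X) ∧ IsFinite (g ∣_ U) ∧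
        UniversallyInjective (g ∣_ U) := by
  haveI : IsDominant h := ⟨hsurj.denseRange⟩
  obtain ⟨N, ψ, φ, hN, hφ, hψfin, hψui, hψsurj⟩ :=
    exists_frobeniusCover_of_finite_universallyInjective hp K X Y f h hYn
  haveI := hN; haveI := hφ; haveI := hψfin; haveI := hψui
  haveI : Surjective ψ := ⟨hψsurj⟩
  -- `Y ≅ N`: transport the conclusion along the isomorphism `φ⁻¹ : Y → N`
  have hN' := pialtConclusion_of_finite_universallyInjective_surjective (inv φ) hY
  -- and push it down the Frobenius cover `ψ : N → X`
  exact pialtConclusion_of_finite_universallyInjective_surjective ψ hN'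

/-- **Finite radicial covers of resolvable normal varieties over perfect fields satisfy `Pialt`**:
over a perfect field of characteristic `p`, if `h : X → Y` is finite, universally injective and
surjective between integral schemes with `Y` normal, locally of finite type and admitting a
resolution of singularities (e.g. `Y` regular), then `X` has a purely inseparable regular
alteration. This covers the class of the route's crux `Picover` (finite radicial covers of
REGULAR varieties, e.g. Temkin's local models `t^{p^e} = a`), whose resolution is open from
dimension `4`: over perfect fields `Pialt` holds on it unconditionally.
[cite: Temkin2013, Rem. 1.3.5(i)–(iii)] -/
theorem pialtConclusion_of_radicialCover_of_hasResolution_perfectField {p : ℕ} (hp : p.Prime)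
    (K : Type) [Field K] [CharP K p] [PerfectField K] (X Y : Scheme.{0}) [IsIntegral X]
    [IsIntegral Y] (f : Y ⟶ Spec (.of K)) [LocallyOfFiniteType f] (h : X ⟶ Y) [IsFinite h]
    [UniversallyInjective h] (hsurj : Function.Surjective h.base)
    (hYn : ∀ y : Y, IsIntegrallyClosed (Y.presheaf.stalk y)) (hres : Scheme.HasResolution Y) :
    ∃ (X' : Scheme.{0}) (g : X' ⟶ X), IsProper g ∧ IsIntegral X' ∧ Scheme.IsRegular X' ∧
      Function.Surjective g.base ∧ ∃ U : X.Opens, Dense (U : Set X) ∧ IsFinite (g ∣_ U) ∧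
        UniversallyInjective (g ∣_ U) :=
  pialtConclusion_of_finite_universallyInjective_surjective_perfectField hp K X Y f h hsurj hYn
    (pialtConclusion_of_hasResolution Y hres)

/-- **The `Picover` shape, regular base, perfect field**: in the binder shape of the route's crux
`Picover` restricted to perfect ground fields, the conclusion of `Pialt` (not the resolution!)
holds for the cover `X` — `Y` regular is normal (`isIntegrallyClosed_of_isRegularLocalRing`) and
satisfies the conclusion via the identity. [cite: Temkin2013, Rem. 1.3.5(iii)] -/
theorem pialtConclusion_of_picoverShape_perfectField {p : ℕ} (hp : p.Prime) (K : Type) [Field K]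
    [CharP K p] [PerfectField K] (Y X : Scheme.{0}) (f : Y ⟶ Spec (.of K)) (g : X ⟶ Y)
    [LocallyOfFiniteType f] [IsIntegral Y] (hreg : Scheme.IsRegular Y) [IsIntegral X]
    [IsFinite g] [UniversallyInjective g] (hsurj : Function.Surjective g.base) :
    ∃ (X' : Scheme.{0}) (g' : X' ⟶ X), IsProper g' ∧ IsIntegral X' ∧ Scheme.IsRegular X' ∧
      Function.Surjective g'.base ∧ ∃ U : X.Opens, Dense (U : Set X) ∧ IsFinite (g' ∣_ U) ∧
        UniversallyInjective (g' ∣_ U) :=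
  pialtConclusion_of_finite_universallyInjective_surjective_perfectField hp K X Y f g hsurj
    (fun y => haveI := hreg y; isIntegrallyClosed_of_isRegularLocalRing (Y.presheaf.stalk y))
    (pialtConclusion_of_isRegular Y hreg)

end Summit.ResolutionOfSingularities.ResolutionOfSingularities.Theorems

end
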